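import Summits.BirchSwinnertonDyer.BirchSwinnertonDyer.Theorems.Rank2ObservatoryTateDeepEngine
import HarnessLib

/-!
# Rank-2 observatory (b2b-bsdr2, cert-2 gen 7): Tate certificates for Steps 6–10 — part 2/3:
# the `Iₙ*` sub-procedure on ONE model, and the plumbing to `kodairaSymbolAt` / `ordMinimalDiscriminant`

HONEST FRAMING: per-curve certified theorems and census instruments; no claim on BSD in rank ≥ 2.

## Why ONE model suffices for `Iₙ*`

The literal algorithm (`istarIndexAux`) translates at every round of the `Iₙ*` sub-procedure; but
the FINAL model `M` (the one on which round `m` exits) is normalised for round `m`, HENCE for every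
earlier round `j < m`, where both tests then fail ON `M` ITSELF (their quadratics are `Y²` and
`ā₂X²`, each with one double root): `istarIndexAux_idle_round` instantiates the tree's
`istarIndexAux_succ_of_not_testB` with all three models equal to `M` (`C = 1`), and
`istarIndexAux_skip` iterates it, so `istarIndexAux (fuel + m) 0 M = istarIndexAux fuel m M`, which
the exit test of round `m` evaluates (`istarIndexAux_succ_of_testA` / `_of_testB`).  Steps 1–7 on
`M` are `kodairaSymbolOfMinimal_eq_Istar_of_models` with `W₂ = W₆ = W₇ = M`.  Result:
`kodairaSymbolOfMinimal_intCast_eq_Istar_odd` (`I*_{2m+1}`, first test of round `m`) and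
`kodairaSymbolOfMinimal_intCast_eq_Istar_even` (`I*_{2m+2}`, second test), from integer
divisibilities of ONE model and one integer non-divisibility.

## Plumbing

`kodairaSymbolAt_and_ordMinimalDiscriminant_of_intModel` identifies the `v`-adic integral model of
`M ⊗ ℚ` with the cast of `M` and reads `kodairaSymbolAt v` / `ordMinimalDiscriminant v` of `W₀ ⊗ ℚ`
(`M = (1,r,s,t) • W₀`) on it — GIVEN that `M ⊗ ℚ` is minimal at `v`; `isMinimalAt_translate` moves
minimality along an integral translation and `isMinimalAt_of_criterion` is Silverman's criterion
(`v(Δ) < 12` or `v(c₄) < 4`, *AEC* VII.1.1) on integer models.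
-/

open scoped NumberField
open Polynomial IsLocalRing IsDedekindDomain Rat.HeightOneSpectrum WeierstrassCurve
  Literature.NumberTheory.EllipticCurves Literature.NumberTheory.GaloisRepresentations
  Literature.NumberTheory.DiophantineGeometry Literature.NumberTheory.DiophantineGeometry.TateAlgorithm

namespace Summit.BirchSwinnertonDyer.BirchSwinnertonDyer.Rank2Observatory.Tate

section DVR

variable {R : Type*} [CommRing R] [IsDomain R] [IsDiscreteValuationRing R] {p : ℕ} {ε : R}

/-! ### The `Iₙ*` branch on ONE model: the final-round model is normalised for every earlier round -/

/-- One idle round of the `Iₙ*` sub-procedure: if `W` is already normalised for round `j + 1`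
(`ϖ ∣ a₁`, `ϖ ∥ a₂`, `ϖ^{j+3} ∣ a₃`, `ϖ^{j+4} ∣ a₄`, `ϖ^{2j+6} ∣ a₆`) then both tests of round `j`
fail ON `W` (their quadratics are `Y²` and `ā₂ X²`) and round `j` hands over to round `j + 1` on the
same model: `istarIndexAux (fuel+1) j W = istarIndexAux fuel (j+1) W`
(`istarIndexAux_succ_of_not_testB` with all three models equal to `W`).
[cite: Silverman1994, IV.9.4 Step 7] -/
theorem istarIndexAux_idle_round [PerfectField (ResidueField R)] {W : WeierstrassCurve R} {j : ℕ}
    (fuel : ℕ) (h1 : uniformizer R ∣ W.a₁) (h2 : uniformizer R ∣ W.a₂)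
    (h2n : ¬ uniformizer R ^ 2 ∣ W.a₂) (h3 : uniformizer R ^ (j + 3) ∣ W.a₃)
    (h4 : uniformizer R ^ (j + 4) ∣ W.a₄) (h6 : uniformizer R ^ (2 * j + 6) ∣ W.a₆) :
    istarIndexAux (fuel + 1) j W = istarIndexAux fuel (j + 1) W := by
  have ha₂ : redCoeff W.a₂ 1 ≠ 0 := by
    rw [Ne, redCoeff_eq_zero_iff (by rwa [pow_one])]; exact h2n
  have w3 : uniformizer R ^ (j + 2) ∣ W.a₃ := (pow_dvd_pow _ (by omega)).trans h3
  have w4 : uniformizer R ^ (j + 3) ∣ W.a₄ := (pow_dvd_pow _ (by omega)).trans h4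
  have w6 : uniformizer R ^ (2 * j + 4) ∣ W.a₆ := (pow_dvd_pow _ (by omega)).trans h6
  have w6' : uniformizer R ^ (2 * j + 5) ∣ W.a₆ := (pow_dvd_pow _ (by omega)).trans h6
  have z3 : redCoeff W.a₃ (j + 2) = 0 := redCoeff_eq_zero_of_dvd h3
  have z6 : redCoeff W.a₆ (2 * j + 4) = 0 :=
    redCoeff_eq_zero_of_dvd ((pow_dvd_pow _ (by omega)).trans h6)
  have z4 : redCoeff W.a₄ (j + 3) = 0 := redCoeff_eq_zero_of_dvd h4
  have z6' : redCoeff W.a₆ (2 * j + 5) = 0 :=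
    redCoeff_eq_zero_of_dvd ((pow_dvd_pow _ (by omega)).trans h6)
  have hA : distinctRootCount (X ^ 2 + C (redCoeff W.a₃ (j + 2)) * X
      - C (redCoeff W.a₆ (2 * j + 4))) ≠ 2 := by
    rw [Ne, TateAlgorithm.distinctRootCount_sq_add_sub_eq_two_iff, z3, z6]; simp
  have hB : distinctRootCount (C (redCoeff W.a₂ 1) * X ^ 2 + C (redCoeff W.a₄ (j + 3)) * X
      + C (redCoeff W.a₆ (2 * j + 5))) ≠ 2 := by
    rw [Ne, distinctRootCount_quadratic_eq_two_iff_ne_zero ha₂, z4, z6']; simp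
  have h6'' : uniformizer R ^ (2 * (j + 1) + 4) ∣ W.a₆ := by
    rw [show 2 * (j + 1) + 4 = 2 * j + 6 by ring]; exact h6
  exact istarIndexAux_succ_of_not_testB h1 h2 h2n w3 w4 w6 hA (one_smul _ W).symm h1 h2 h2n h3 w4
    w6' hB (one_smul _ W).symm h1 h2 h2n h3 h4 h6''

/-- The idle rounds `0, …, m-1` on one model normalised for round `m`:
`istarIndexAux (fuel + j) 0 W = istarIndexAux fuel j W` for `j ≤ m`. [cite: Silverman1994, IV.9.4 Step 7] -/
theorem istarIndexAux_skip [PerfectField (ResidueField R)] {W : WeierstrassCurve R} {m : ℕ}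
    (h1 : uniformizer R ∣ W.a₁) (h2 : uniformizer R ∣ W.a₂) (h2n : ¬ uniformizer R ^ 2 ∣ W.a₂)
    (h3 : uniformizer R ^ (m + 2) ∣ W.a₃) (h4 : uniformizer R ^ (m + 3) ∣ W.a₄)
    (h6 : uniformizer R ^ (2 * m + 4) ∣ W.a₆) :
    ∀ j ≤ m, ∀ fuel, istarIndexAux (fuel + j) 0 W = istarIndexAux fuel j W := by
  intro j
  induction j with
  | zero => intro _ fuel; rfl
  | succ j ih =>
    intro hj fuel
    rw [show fuel + (j + 1) = (fuel + 1) + j by ring, ih (by omega) (fuel + 1)]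
    exact istarIndexAux_idle_round fuel h1 h2 h2n ((pow_dvd_pow _ (by omega)).trans h3)
      ((pow_dvd_pow _ (by omega)).trans h4) ((pow_dvd_pow _ (by omega)).trans h6)

/-- Steps 1–7 on ONE integer model normalised for some round of the `Iₙ*` sub-procedure
(`p ∣ a₁`, `p ∥ a₂`, `p² ∣ a₃`, `p³ ∣ a₄`, `p⁴ ∣ a₆`): the type is `Iₙ*` with
`n = istarIndexAux (ord Δ) 0` of the cast model (`kodairaSymbolOfMinimal_eq_Istar_of_models` with
`W₂ = W₆ = W₇` the cast model; its cubic is `T³ + ā₂,₁ T²`, two distinct roots).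
[cite: Silverman1994, IV.9.4 Steps 1–7] -/
theorem kodairaSymbolOfMinimal_intCast_eq_Istar_aux [PerfectField (ResidueField R)] (hp : p.Prime)
    (hε : IsUnit ε) (hpε : (p : R) = uniformizer R * ε) {M : WeierstrassCurve ℤ}
    (h1 : (p : ℤ) ^ 1 ∣ M.a₁) (h2 : (p : ℤ) ^ 1 ∣ M.a₂) (h2' : ¬ (p : ℤ) ^ (1 + 1) ∣ M.a₂)
    (h3 : (p : ℤ) ^ 2 ∣ M.a₃) (h4 : (p : ℤ) ^ 3 ∣ M.a₄) (h6 : (p : ℤ) ^ 4 ∣ M.a₆) :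
    (M.map (Int.castRingHom R)).kodairaSymbolOfMinimal =
      .Istar (istarIndexAux
        (IsDiscreteValuationRing.addVal R (M.map (Int.castRingHom R)).Δ).toNat 0
        (M.map (Int.castRingHom R))) := by
  obtain ⟨e1, e2, e3, e4, e6, -⟩ := map_intCast_eqs (R := R) M
  set I := M.map (Int.castRingHom R)
  have q1 : uniformizer R ∣ I.a₁ := by rw [e1]; exact uniformizer_dvd_intCast hpε h1
  have q2 : uniformizer R ∣ I.a₂ := by rw [e2]; exact uniformizer_dvd_intCast hpε h2
  have q2n : ¬ uniformizer R ^ 2 ∣ I.a₂ := by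
    rw [e2]; exact not_pow_succ_dvd_intCast hp hε hpε h2 h2'
  have s3 : uniformizer R ^ 2 ∣ I.a₃ := by rw [e3]; exact uniformizer_pow_dvd_intCast hpε h3
  have s4 : uniformizer R ^ 3 ∣ I.a₄ := by rw [e4]; exact uniformizer_pow_dvd_intCast hpε h4
  have s6 : uniformizer R ^ 4 ∣ I.a₆ := by rw [e6]; exact uniformizer_pow_dvd_intCast hpε h6
  have q4 : uniformizer R ^ 2 ∣ I.a₄ := (pow_dvd_pow _ (by norm_num)).trans s4
  have q6 : uniformizer R ^ 3 ∣ I.a₆ := (pow_dvd_pow _ (by norm_num)).trans s6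
  obtain ⟨hΔ, n3, n4, n6, hb₂, ha₆, hb₈, hb₆⟩ := tests_of_step6 q1 q2 s3 q4 q6
  have hc : redCoeff I.a₂ 1 ≠ 0 := by
    rw [Ne, redCoeff_eq_zero_iff (by rwa [pow_one])]; exact q2n
  have h7 : distinctRootCount (cubicStep6 I) = 2 := by
    rw [cubicStep6, redCoeff_eq_zero_of_dvd s4, redCoeff_eq_zero_of_dvd s6,
      distinctRootCount_cubic_eq_two_iff _ _ _ (by ring)]
    simpa using hc
  exact kodairaSymbolOfMinimal_eq_Istar_of_models hΔ (one_smul _ I).symm n3 n4 n6 hb₂ ha₆ hb₈ hb₆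
    (one_smul _ I).symm q1 q2 s3 q4 q6 h7 (one_smul _ I).symm q1 q2 q2n s3 s4 s6

/-- **Type `I*_{2m+1}` read on an integer model** (Step 7, first test of round `m` fires): if
`p ∣ a₁`, `p ∥ a₂`, `p^{m+2} ∣ a₃`, `p^{m+3} ∣ a₄`, `p^{2m+4} ∣ a₆`,
`p ∤ (a₃/p^{m+2})² + 4 (a₆/p^{2m+4})`, and `pⁿ ∥ Δ` with `m + 1 ≤ n` (fuel), then Tate's algorithm
returns `I*_{2m+1}` on the cast model: rounds `0 … m-1` are idle on this model
(`istarIndexAux_skip`) and the first quadratic of round `m` is `Y² + ε̄^{m+2}A₃ Y - ε̄^{2m+4}A₆`.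
[cite: Silverman1994, IV.9.4 Step 7] -/
theorem kodairaSymbolOfMinimal_intCast_eq_Istar_odd [PerfectField (ResidueField R)] (hp : p.Prime)
    (hε : IsUnit ε) (hpε : (p : R) = uniformizer R * ε) {M : WeierstrassCurve ℤ} {m n : ℕ}
    (h1 : (p : ℤ) ^ 1 ∣ M.a₁) (h2 : (p : ℤ) ^ 1 ∣ M.a₂) (h2' : ¬ (p : ℤ) ^ (1 + 1) ∣ M.a₂)
    (h3 : (p : ℤ) ^ (m + 2) ∣ M.a₃) (h4 : (p : ℤ) ^ (m + 3) ∣ M.a₄)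
    (h6 : (p : ℤ) ^ (2 * m + 4) ∣ M.a₆)
    (hA : ¬ (p : ℤ) ^ 1 ∣ (M.a₃ / (p : ℤ) ^ (m + 2)) ^ 2 + 4 * (M.a₆ / (p : ℤ) ^ (2 * m + 4)))
    (hΔ : (p : ℤ) ^ n ∣ M.Δ) (hΔ' : ¬ (p : ℤ) ^ (n + 1) ∣ M.Δ) (hfuel : m + 1 ≤ n) :
    (M.map (Int.castRingHom R)).kodairaSymbolOfMinimal = .Istar (2 * m + 1) := by
  obtain ⟨e1, e2, e3, e4, e6, eΔ⟩ := map_intCast_eqs (R := R) M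
  have hē := residue_ne_zero_of_isUnit hε
  rw [kodairaSymbolOfMinimal_intCast_eq_Istar_aux hp hε hpε h1 h2 h2'
    ((pow_dvd_pow _ (by omega)).trans h3) ((pow_dvd_pow _ (by omega)).trans h4)
    ((pow_dvd_pow _ (by omega)).trans h6), eΔ, addVal_intCast_toNat_eq hp hε hpε hΔ hΔ']
  set I := M.map (Int.castRingHom R)
  have q1 : uniformizer R ∣ I.a₁ := by rw [e1]; exact uniformizer_dvd_intCast hpε h1
  have q2 : uniformizer R ∣ I.a₂ := by rw [e2]; exact uniformizer_dvd_intCast hpε h2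
  have q2n : ¬ uniformizer R ^ 2 ∣ I.a₂ := by
    rw [e2]; exact not_pow_succ_dvd_intCast hp hε hpε h2 h2'
  have r3 : uniformizer R ^ (m + 2) ∣ I.a₃ := by rw [e3]; exact uniformizer_pow_dvd_intCast hpε h3
  have r4 : uniformizer R ^ (m + 3) ∣ I.a₄ := by rw [e4]; exact uniformizer_pow_dvd_intCast hpε h4
  have r6 : uniformizer R ^ (2 * m + 4) ∣ I.a₆ := by
    rw [e6]; exact uniformizer_pow_dvd_intCast hpε h6
  obtain ⟨f, rfl⟩ : ∃ f, n = f + 1 + m := ⟨n - m - 1, by omega⟩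
  rw [istarIndexAux_skip q1 q2 q2n r3 r4 r6 m le_rfl (f + 1)]
  congr 1
  apply istarIndexAux_succ_of_testA
  rw [TateAlgorithm.distinctRootCount_sq_add_sub_eq_two_iff, e3, e6, redCoeff_intCast hpε h3,
    redCoeff_intCast hpε h6]
  rw [pow_one] at hA
  have key : ∀ (e A C : ResidueField R), (e ^ (m + 2) * A) ^ 2 + 4 * (e ^ (2 * m + 4) * C) =
      e ^ (2 * m + 4) * (A ^ 2 + 4 * C) := by intros; ring
  rw [key]
  refine mul_ne_zero (pow_ne_zero _ hē) ?_
  have := residue_intCast_ne_zero hp hpε hA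
  simpa [map_ofNat] using this

/-- **Type `I*_{2m+2}` read on an integer model** (Step 7, second test of round `m` fires): if
`p ∣ a₁`, `p ∥ a₂`, `p^{m+3} ∣ a₃`, `p^{m+3} ∣ a₄`, `p^{2m+5} ∣ a₆`,
`p ∤ (a₄/p^{m+3})² - 4 (a₂/p)(a₆/p^{2m+5})`, and `pⁿ ∥ Δ` with `m + 1 ≤ n`, then Tate's algorithm
returns `I*_{2m+2}` on the cast model (the first quadratic of round `m` is `Y²`; the second is
`ε̄A₂ X² + ε̄^{m+3}A₄ X + ε̄^{2m+5}A₆`, discriminant `ε̄^{2m+6}(A₄² - 4A₂A₆)`).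
[cite: Silverman1994, IV.9.4 Step 7] -/
theorem kodairaSymbolOfMinimal_intCast_eq_Istar_even [PerfectField (ResidueField R)] (hp : p.Prime)
    (hε : IsUnit ε) (hpε : (p : R) = uniformizer R * ε) {M : WeierstrassCurve ℤ} {m n : ℕ}
    (h1 : (p : ℤ) ^ 1 ∣ M.a₁) (h2 : (p : ℤ) ^ 1 ∣ M.a₂) (h2' : ¬ (p : ℤ) ^ (1 + 1) ∣ M.a₂)
    (h3 : (p : ℤ) ^ (m + 3) ∣ M.a₃) (h4 : (p : ℤ) ^ (m + 3) ∣ M.a₄)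
    (h6 : (p : ℤ) ^ (2 * m + 5) ∣ M.a₆)
    (hB : ¬ (p : ℤ) ^ 1 ∣ (M.a₄ / (p : ℤ) ^ (m + 3)) ^ 2
      - 4 * (M.a₂ / (p : ℤ) ^ 1) * (M.a₆ / (p : ℤ) ^ (2 * m + 5)))
    (hΔ : (p : ℤ) ^ n ∣ M.Δ) (hΔ' : ¬ (p : ℤ) ^ (n + 1) ∣ M.Δ) (hfuel : m + 1 ≤ n) :
    (M.map (Int.castRingHom R)).kodairaSymbolOfMinimal = .Istar (2 * m + 2) := by
  obtain ⟨e1, e2, e3, e4, e6, eΔ⟩ := map_intCast_eqs (R := R) M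
  have hē := residue_ne_zero_of_isUnit hε
  rw [kodairaSymbolOfMinimal_intCast_eq_Istar_aux hp hε hpε h1 h2 h2'
    ((pow_dvd_pow _ (by omega)).trans h3) ((pow_dvd_pow _ (by omega)).trans h4)
    ((pow_dvd_pow _ (by omega)).trans h6), eΔ, addVal_intCast_toNat_eq hp hε hpε hΔ hΔ']
  set I := M.map (Int.castRingHom R)
  have q1 : uniformizer R ∣ I.a₁ := by rw [e1]; exact uniformizer_dvd_intCast hpε h1
  have q2 : uniformizer R ∣ I.a₂ := by rw [e2]; exact uniformizer_dvd_intCast hpε h2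
  have q2n : ¬ uniformizer R ^ 2 ∣ I.a₂ := by
    rw [e2]; exact not_pow_succ_dvd_intCast hp hε hpε h2 h2'
  have k3 : uniformizer R ^ (m + 3) ∣ I.a₃ := by rw [e3]; exact uniformizer_pow_dvd_intCast hpε h3
  have k4 : uniformizer R ^ (m + 3) ∣ I.a₄ := by rw [e4]; exact uniformizer_pow_dvd_intCast hpε h4
  have k6 : uniformizer R ^ (2 * m + 5) ∣ I.a₆ := by
    rw [e6]; exact uniformizer_pow_dvd_intCast hpε h6
  have r3 : uniformizer R ^ (m + 2) ∣ I.a₃ := (pow_dvd_pow _ (by omega)).trans k3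
  have r6 : uniformizer R ^ (2 * m + 4) ∣ I.a₆ := (pow_dvd_pow _ (by omega)).trans k6
  obtain ⟨f, rfl⟩ : ∃ f, n = f + 1 + m := ⟨n - m - 1, by omega⟩
  rw [istarIndexAux_skip q1 q2 q2n r3 k4 r6 m le_rfl (f + 1)]
  congr 1
  have hA : distinctRootCount (X ^ 2 + C (redCoeff I.a₃ (m + 2)) * X
      - C (redCoeff I.a₆ (2 * m + 4))) ≠ 2 := by
    rw [Ne, TateAlgorithm.distinctRootCount_sq_add_sub_eq_two_iff, redCoeff_eq_zero_of_dvd k3,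
      redCoeff_eq_zero_of_dvd ((pow_dvd_pow _ (by omega)).trans k6)]
    simp
  have ha : redCoeff I.a₂ 1 ≠ 0 := by
    rw [Ne, redCoeff_eq_zero_iff (by rwa [pow_one])]; exact q2n
  refine istarIndexAux_succ_of_testB q1 q2 q2n r3 k4 r6 hA (one_smul _ I).symm q1 q2 q2n k3 k4 k6 ?_
  rw [distinctRootCount_quadratic_eq_two_iff_ne_zero ha, e2, e4, e6, redCoeff_intCast hpε h2,
    redCoeff_intCast hpε h4, redCoeff_intCast hpε h6]
  rw [pow_one] at hB
  have key : ∀ (e A B C : ResidueField R), (e ^ (m + 3) * B) ^ 2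
      - 4 * (e ^ 1 * A) * (e ^ (2 * m + 5) * C) = e ^ (2 * m + 6) * (B ^ 2 - 4 * A * C) := by
    intros; ring
  rw [key]
  refine mul_ne_zero (pow_ne_zero _ hē) ?_
  have := residue_intCast_ne_zero hp hpε hB
  simpa [map_ofNat] using this

end DVR

/-! ### Plumbing: from the cast model in `O_v` to `kodairaSymbolAt v` / `ordMinimalDiscriminant v` -/

section Padic

variable (v : HeightOneSpectrum (𝓞 ℚ))

/-- **From an integer model to the place `v`.**  Let `M = D • W₀` with `D = (1, r, s, t)` integral,
`M ⊗ ℚ` minimal at `v`, `pⁿ ∥ Δ(M)` with `p` the prime below `v`, and suppose Tate's algorithm returns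
`T` on the cast of `M` in EVERY presentation `p = ϖ ε` (`ε ∈ O_vˣ`) of `O_v`.  Then `W₀ ⊗ ℚ` has
Kodaira type `T` and `ord_v Δ_min = n` at `v` (the integral model of `M ⊗ ℚ ⊗ ℚ_v` IS the cast of
`M`; `kodairaSymbolAt` / `ordMinimalDiscriminant` are read on any minimal model).
[cite: Silverman1994, IV.9.4] [cite: SilvermanAEC2009, VII.1] -/
theorem kodairaSymbolAt_and_ordMinimalDiscriminant_of_intModel {p : ℕ} (hv : natGenerator v = p)
    (W₀ M : WeierstrassCurve ℤ) (D : VariableChange ℤ) (hD : D.u = 1) (hM : M = D • W₀)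
    (hmin : (M.baseChange ℚ).IsMinimalAt v) {n : ℕ} (hΔ : (p : ℤ) ^ n ∣ M.Δ)
    (hΔ' : ¬ (p : ℤ) ^ (n + 1) ∣ M.Δ) {T : KodairaSymbol}
    (hT : ∀ ε : v.adicCompletionIntegers ℚ, IsUnit ε →
      (p : v.adicCompletionIntegers ℚ) = uniformizer (v.adicCompletionIntegers ℚ) * ε →
      (M.map (Int.castRingHom (v.adicCompletionIntegers ℚ))).kodairaSymbolOfMinimal = T) :
    (W₀.baseChange ℚ).kodairaSymbolAt v = T ∧ (W₀.baseChange ℚ).ordMinimalDiscriminant v = n := by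
  haveI := perfectField_residueField_adicCompletionIntegers (K := ℚ) v
  have hp : p.Prime := hv ▸ prime_natGenerator v
  have hΔM0 : M.Δ ≠ 0 := by rintro h0; rw [h0] at hΔ'; exact hΔ' (dvd_zero _)
  have hΔW : M.Δ = W₀.Δ := by rw [hM, variableChange_Δ, hD]; simp
  have hΔ0 : (W₀.baseChange ℚ).Δ ≠ 0 := by
    rw [(Step2Cert.baseChange_eqs W₀).2.2.2.2.2.2.2.2, Int.cast_ne_zero, ← hΔW]; exact hΔM0
  haveI : (W₀.baseChange ℚ).IsElliptic := ⟨hΔ0.isUnit⟩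
  have hrelq : M.baseChange ℚ = (D.map (algebraMap ℤ ℚ)) • W₀.baseChange ℚ := by
    rw [hM, WeierstrassCurve.baseChange, WeierstrassCurve.baseChange, map_variableChange]
  haveI hMell : (M.baseChange ℚ).IsElliptic := by rw [hrelq]; infer_instance
  set X := (M.baseChange ℚ).baseChange (v.adicCompletion ℚ) with hX
  haveI hXmin : X.IsMinimal (v.adicCompletionIntegers ℚ) := hmin
  haveI hXell : X.IsElliptic := by rw [hX, WeierstrassCurve.baseChange]; infer_instance
  -- the integral model of `X` is the cast of `M`
  have hva : ∀ (x : v.adicCompletionIntegers ℚ) (a : ℤ),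
      algebraMap (v.adicCompletionIntegers ℚ) (v.adicCompletion ℚ) x =
        algebraMap ℚ (v.adicCompletion ℚ) ((a : ℤ) : ℚ) → x = (a : v.adicCompletionIntegers ℚ) := by
    intro x a h
    apply IsFractionRing.injective (v.adicCompletionIntegers ℚ) (v.adicCompletion ℚ)
    rw [h, map_intCast, map_intCast]
  obtain ⟨e₁, e₂, e₃, e₄, e₆, -, -, -, eΔ⟩ := Step2Cert.baseChange_eqs M
  have hI : X.integralModel (v.adicCompletionIntegers ℚ) =
      M.map (Int.castRingHom (v.adicCompletionIntegers ℚ)) := by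
    refine WeierstrassCurve.ext ?_ ?_ ?_ ?_ ?_
    · refine (hva _ M.a₁ ?_).trans rfl
      rw [integralModel_a₁_eq, hX, WeierstrassCurve.baseChange, map_a₁, e₁]
    · refine (hva _ M.a₂ ?_).trans rfl
      rw [integralModel_a₂_eq, hX, WeierstrassCurve.baseChange, map_a₂, e₂]
    · refine (hva _ M.a₃ ?_).trans rfl
      rw [integralModel_a₃_eq, hX, WeierstrassCurve.baseChange, map_a₃, e₃]
    · refine (hva _ M.a₄ ?_).trans rfl
      rw [integralModel_a₄_eq, hX, WeierstrassCurve.baseChange, map_a₄, e₄]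
    · refine (hva _ M.a₆ ?_).trans rfl
      rw [integralModel_a₆_eq, hX, WeierstrassCurve.baseChange, map_a₆, e₆]
  -- a presentation `p = ϖ ε`
  have hpval : Valued.v (((p : v.adicCompletionIntegers ℚ)) : v.adicCompletion ℚ) =
      WithZero.exp (-((1 : ℕ) : ℤ)) := by
    rw [show ((p : v.adicCompletionIntegers ℚ) : v.adicCompletion ℚ) =
        algebraMap _ (v.adicCompletion ℚ) (p : v.adicCompletionIntegers ℚ) from rfl, map_natCast,
      ← map_natCast (algebraMap ℚ (v.adicCompletion ℚ)) p,
      WeierstrassCurve.valued_algebraMap_adicCompletion, ← hv]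
    exact_mod_cast Rat.valuation_natGenerator v
  obtain ⟨ε, hε, hpε⟩ := exists_isUnit_eq_uniformizer_pow_mul_of_valued_eq v hpval
  rw [pow_one] at hpε
  have hK := hT ε hε hpε
  have hrel : X = ((D.map (algebraMap ℤ ℚ)).map (algebraMap ℚ (v.adicCompletion ℚ))) •
      (W₀.baseChange ℚ).baseChange (v.adicCompletion ℚ) := by
    rw [hX, hrelq]; simp only [WeierstrassCurve.baseChange, map_variableChange]
  refine ⟨?_, ?_⟩
  · rw [(W₀.baseChange ℚ).kodairaSymbolAt_eq_kodairaSymbolOfMinimal_of_isMinimal v X _ hrel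
      X.isUnit_Δ.ne_zero, hI, hK]
  · rw [(W₀.baseChange ℚ).ordMinimalDiscriminant_eq_of_isMinimal v X _ hrel X.isUnit_Δ.ne_zero, hI,
      (map_intCast_eqs (R := v.adicCompletionIntegers ℚ) M).2.2.2.2.2]
    exact addVal_intCast_toNat_eq hp hε hpε hΔ hΔ'

/-- Minimality at `v` of the translate `M = (1,r,s,t) • W₀` from minimality of `W₀ ⊗ ℚ`. [folklore] -/
theorem isMinimalAt_translate {W₀ M : WeierstrassCurve ℤ} (D : VariableChange ℤ) (hD : D.u = 1)
    (hM : M = D • W₀) (hmin : (W₀.baseChange ℚ).IsMinimalAt v) :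
    (M.baseChange ℚ).IsMinimalAt v := by
  have hrelq : M.baseChange ℚ = (D.map (algebraMap ℤ ℚ)) • W₀.baseChange ℚ := by
    rw [hM, WeierstrassCurve.baseChange, WeierstrassCurve.baseChange, map_variableChange]
  rw [IsMinimalAt, hrelq]
  refine isMinimal_adicCompletion_smul hmin _ ?_ ?_ ?_ ?_
  · simp [VariableChange.map, hD]
  · simpa [VariableChange.map] using WeierstrassCurve.Rat.valuation_intCast_le_one v D.r
  · simpa [VariableChange.map] using WeierstrassCurve.Rat.valuation_intCast_le_one v D.s
  · simpa [VariableChange.map] using WeierstrassCurve.Rat.valuation_intCast_le_one v D.t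

/-- Minimality at `v` of an integer model from Silverman's criteria `ord_v Δ < 12` or
`ord_v c₄ < 4` (*AEC* VII.1.1). [cite: SilvermanAEC2009, VII.1 Remark 1.1] -/
theorem isMinimalAt_of_criterion {p : ℕ} (hv : natGenerator v = p) (M : WeierstrassCurve ℤ) {n : ℕ}
    (hΔ : (p : ℤ) ^ n ∣ M.Δ) (hΔ' : ¬ (p : ℤ) ^ (n + 1) ∣ M.Δ)
    (hcrit : n < 12 ∨ ∃ k < 4, (p : ℤ) ^ k ∣ M.c₄ ∧ ¬ (p : ℤ) ^ (k + 1) ∣ M.c₄) :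
    (M.baseChange ℚ).IsMinimalAt v := by
  obtain ⟨e₁, e₂, e₃, e₄, e₆, -, -, -, eΔ⟩ := Step2Cert.baseChange_eqs M
  have hint : (M.baseChange ℚ).IsIntegralAt v :=
    (M.baseChange ℚ).isIntegralAt_of_valuation_le_one v
      (by rw [e₁]; exact WeierstrassCurve.Rat.valuation_intCast_le_one v _)
      (by rw [e₂]; exact WeierstrassCurve.Rat.valuation_intCast_le_one v _)
      (by rw [e₃]; exact WeierstrassCurve.Rat.valuation_intCast_le_one v _)
      (by rw [e₄]; exact WeierstrassCurve.Rat.valuation_intCast_le_one v _)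
      (by rw [e₆]; exact WeierstrassCurve.Rat.valuation_intCast_le_one v _)
  rcases hcrit with hn | ⟨k, hk, hc, hc'⟩
  · refine isMinimalAt_of_lt_valuation_Δ_holds hint ?_
    rw [eΔ, valuation_eq_of_pow_dvd_of_not v hv hΔ hΔ']
    exact WithZero.exp_lt_exp.mpr (by omega)
  · refine isMinimalAt_of_lt_valuation_c₄ hint ?_
    have ec₄ : (M.baseChange ℚ).c₄ = (M.c₄ : ℚ) := by simp [WeierstrassCurve.baseChange, map_c₄]
    rw [ec₄, valuation_eq_of_pow_dvd_of_not v hv hc hc']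
    exact WithZero.exp_lt_exp.mpr (by omega)

end Padic

end Summit.BirchSwinnertonDyer.BirchSwinnertonDyer.Rank2Observatory.Tate
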